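import Summits.CriticalPhenomena.PercolationContinuityZ3.Theorems.PercNearOneGluingNoHeavyLowerTailSahiE3ExchangeEmptyLayer
import Mathlib.Tactic.Linarith
import Mathlib.Tactic.Ring
import Mathlib.Tactic.Positivity
import HarnessLib
import HarnessLib.Audit

/-!
# `NoHeavyLowerTail` (crux stmt-CriticalPhenomena-4575), Sahi programme P4: the 2×2 exchange lemma — empty PRIMED layer (`K' = O' = ∅` or `L' = O' = ∅`), both brackets

Support file (cell `prim-l12`, seat P4, generation 23; `--supports stmt-CriticalPhenomena-4575`).  No named facts, no sorries;
standard axioms; def-free.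

Context (HOME prim-l12-p4/FROM-prim-l12-p4-gen23-*.md; predecessor `…SahiE3ExchangeEmptyLayer`, which proves the UNPRIMED empty-layer
classes `L = O = ∅` and `K = O = ∅` of the 2×2 exchange lemma for both brackets).  By the σ-symmetry `(K,L,P,O) ↔ (L',K',P',O')` of the
type-2 expression the primed classes follow for the type-2 bracket, but the type-1 bracket `Har(P,P') + (p−k)(k'−o') + (p−o)(p'−k')` is
not σ-symmetric; this file proves the PRIMED empty-layer classes directly, for ANY bracket value `Y` dominating one product:
* `K' = O' = ∅` (`exchange_of_emptyLayerKp`): the exchange expression reduces to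
  `w(PP'V) − w(P')w(OV) + R(LL'V) − need(K,L') + (1−v)·Y`; the single sub-pair `(K∩L, L')` (footprint inside `L∩L'`) leaves the
  deficit `need(K,L') − need(K∩L,L') = (k−m)·a(L') + l'·(a(K)−a(K∩L)) − v(k−m)l'` (`m = w(K∩L)`), paid termwise by
  `Har(P';P_V) + [p'·(a(P)−a(O)) − l'·(a(K)−a(K∩L))] + [(1−v)Y − (k−m)(a(L')−v·l')]` whenever `Y ≥ (k−m)·l'` — true for the type-2 bracket
  (`(p−l)·p' ≥ (k−m)·l'`) and the type-1 bracket (`(p−o)·p' ≥ (k−m)·l'`);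
* `L' = O' = ∅` (`exchange_of_emptyLayerLp`): sub-pair `(K∩L, K')`, deficit `(l−m)a(K') + k'(a(L)−a(K∩L)) − v(l−m)k'`, bracket condition
  `Y ≥ (l−m)·k'` (type 2: `(p−k)p'`; type 1: `(p−k)k'`).
Numerically (HOME memo; n = 3 exhaustive over all slots and configurations, 3.7 M crossing configurations per weight vector) the sub-pair
certifies every such configuration for both brackets.  With this file the tree covers all four empty-layer classes for both brackets; for
the flagship block `x₀∧(x₁∨x₂)` these are exactly the crossing configurations with an empty trace ("Case A" of the memo).
-/

namespace Summit.CriticalPhenomena.PercolationContinuityZ3.Theorems.SahiE3ExchangeEmptyLayerPrimed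

open Finset SahiE3DimerPacking SahiE3ExchangeCross SahiE3ExchangeEmptyLayer
open scoped BigOperators

variable {B : Type*} [DecidableEq B]

/-- **Scalar core of the primed empty-layer classes.**  Reals: `v ≤ 1`; `0 ≤ l' ≤ p'`; `m ≤ k`; trace masses with
`0 ≤ aK − aM ≤ aP − aO` and `aL' ≤ l'`; Harris `p'·aP ≤ aPP'`; a supply `RL ≥ need(M,L') = m·aL' + l'·aM − v·m·l'`; a bracket
`Y ≥ (k−m)·l'`.  Then `0 ≤ aPP' − p'·aO + RL − need(K,L') + (1−v)·Y`. [this work] -/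
theorem emptyLayerPrimed_scalar (v p' k l' m aP aO aK aM aL' aPP' RL Y : ℝ)
    (hv1 : v ≤ 1) (hl'0 : 0 ≤ l') (hl'p' : l' ≤ p') (hmk : m ≤ k)
    (hKM : aK - aM ≤ aP - aO) (hKM0 : 0 ≤ aK - aM) (haL' : aL' ≤ l')
    (hHar : p' * aP ≤ aPP') (hRL : m * aL' + l' * aM - v * m * l' ≤ RL) (hY : (k - m) * l' ≤ Y) :
    0 ≤ aPP' - p' * aO + RL - (k * aL' + l' * aK - v * k * l') + (1 - v) * Y := by
  have F1 : l' * (aK - aM) ≤ p' * (aP - aO) :=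
    calc l' * (aK - aM) ≤ p' * (aK - aM) := mul_le_mul_of_nonneg_right hl'p' hKM0
      _ ≤ p' * (aP - aO) := mul_le_mul_of_nonneg_left hKM (by linarith)
  have F2 : (k - m) * (aL' - v * l') ≤ (1 - v) * Y := by
    have h1 : aL' - v * l' ≤ (1 - v) * l' := by linarith
    calc (k - m) * (aL' - v * l') ≤ (k - m) * ((1 - v) * l') := mul_le_mul_of_nonneg_left h1 (by linarith)
      _ = (1 - v) * ((k - m) * l') := by ring
      _ ≤ (1 - v) * Y := mul_le_mul_of_nonneg_left hY (by linarith)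
  nlinarith [F1, F2, hHar, hRL]

/-- **Four-set trace inequality.**  For `w ≥ 0` on `T` and `O ⊆ K ⊆ P`: `w(KT) + w(OT) ≤ w(PT) + w((K∩L)T)` whenever `O ⊆ L`
(pointwise `1_K + 1_O ≤ 1_P + 1_{K∩L}`), i.e. `a(K) − a(K∩L) ≤ a(P) − a(O)`. [folklore] -/
theorem trace_four (w : B → ℝ) (T K L P O : Finset B) (hw : ∀ b ∈ T, 0 ≤ w b)
    (hOK : O ⊆ K) (hOL : O ⊆ L) (hKP : K ⊆ P) :
    ∑ b ∈ K ∩ T, w b + ∑ b ∈ O ∩ T, w b ≤ ∑ b ∈ P ∩ T, w b + ∑ b ∈ (K ∩ L) ∩ T, w b := by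
  simp only [sum_inter_eq_sum_ite, ← Finset.sum_add_distrib]
  refine Finset.sum_le_sum fun b hb => ?_
  have hwb := hw b hb
  simp only [Finset.mem_inter]
  by_cases hk : b ∈ K <;> by_cases ho : b ∈ O <;> by_cases hp : b ∈ P <;> by_cases hl : b ∈ L <;>
    simp only [hk, ho, hp, hl, and_true, and_false, and_self, ↓reduceIte, add_zero, zero_add, le_refl] <;>
    first
      | exact absurd (hKP hk) hp
      | exact absurd (hOL ho) hl
      | exact absurd (hOK ho) hk
      | linarith

/-- **Empty primed `K`-layer (`K' = O' = ∅`), any bracket `Y ≥ (k−m)·l'`** (see the module docstring).  `B` finite, `w ≥ 0` of total mass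
`1`, `R ≥ 0` on `V`; configuration sets with `O ⊆ K`, `O ⊆ L`, `K ⊆ P`, `L' ⊆ P'`; the pair inequality at `(K∩L, L')`; Harris for `(P', P∩V)`.
Then `w(PP'V) − w(P')w(OV) + R(LL'V) − need(K,L') + (1−v)·Y ≥ 0` — the `K' = O' = ∅` specialisation of the exchange expression (where
`R(KK'V)`, `need(L,K')`, `w(OO'V)`, `w(P)w(O'V)` vanish); type 2: `Y = Har(P,P') + (p−k)(p'−l') + (p−l)p'`, type 1: `Y = Har(P,P') + (p−o)p'`.
[this work] -/
theorem exchange_of_emptyLayerKp [Fintype B] (w R : B → ℝ) (hw : ∀ b, 0 ≤ w b) (hw1 : ∑ b, w b = 1)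
    (V K L P O L' P' : Finset B) (Y : ℝ) (hR : ∀ b ∈ V, 0 ≤ R b)
    (hOK : O ⊆ K) (hOL : O ⊆ L) (hKP : K ⊆ P) (hLP' : L' ⊆ P')
    (hpair : (∑ b ∈ K ∩ L, w b) * (∑ b ∈ L' ∩ V, w b) + (∑ b ∈ L', w b) * (∑ b ∈ (K ∩ L) ∩ V, w b)
        - (∑ b ∈ V, w b) * (∑ b ∈ K ∩ L, w b) * (∑ b ∈ L', w b) ≤ ∑ b ∈ ((K ∩ L) ∩ L') ∩ V, R b)
    (hHarV : (∑ b ∈ P', w b) * (∑ b ∈ P ∩ V, w b) ≤ ∑ b ∈ (P ∩ P') ∩ V, w b)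
    (hY : ((∑ b ∈ K, w b) - ∑ b ∈ K ∩ L, w b) * (∑ b ∈ L', w b) ≤ Y) :
    0 ≤ (∑ b ∈ (P ∩ P') ∩ V, w b) - (∑ b ∈ P', w b) * (∑ b ∈ O ∩ V, w b)
        + (∑ b ∈ (L ∩ L') ∩ V, R b)
        - ((∑ b ∈ K, w b) * (∑ b ∈ L' ∩ V, w b) + (∑ b ∈ L', w b) * (∑ b ∈ K ∩ V, w b)
            - (∑ b ∈ V, w b) * (∑ b ∈ K, w b) * (∑ b ∈ L', w b))
        + (1 - ∑ b ∈ V, w b) * Y := by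
  -- the sub-pair (K∩L, L') draws on the supply R(LL'V)
  have hsup : ∑ b ∈ ((K ∩ L) ∩ L') ∩ V, R b ≤ ∑ b ∈ (L ∩ L') ∩ V, R b :=
    sum_inter_le_of_subset R V (K ∩ L) L' (L ∩ L') hR
      (by intro b hb; simp only [Finset.mem_inter] at hb ⊢; exact ⟨hb.1.2, hb.2⟩)
  have hv1 : ∑ b ∈ V, w b ≤ 1 := by
    rw [← hw1]; exact sum_le_sum_of_subset' w hw (Finset.subset_univ V)
  have hl'0 : 0 ≤ ∑ b ∈ L', w b := Finset.sum_nonneg fun b _ => hw b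
  have hl'p' : ∑ b ∈ L', w b ≤ ∑ b ∈ P', w b := sum_le_sum_of_subset' w hw hLP'
  have hmk : ∑ b ∈ K ∩ L, w b ≤ ∑ b ∈ K, w b := sum_le_sum_of_subset' w hw Finset.inter_subset_left
  have haL' : ∑ b ∈ L' ∩ V, w b ≤ ∑ b ∈ L', w b := sum_le_sum_of_subset' w hw Finset.inter_subset_left
  have hKM0 : ∑ b ∈ (K ∩ L) ∩ V, w b ≤ ∑ b ∈ K ∩ V, w b :=
    sum_le_sum_of_subset' w hw (Finset.inter_subset_inter Finset.inter_subset_left le_rfl)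
  have h4 := trace_four w V K L P O (fun b _ => hw b) hOK hOL hKP
  exact emptyLayerPrimed_scalar (∑ b ∈ V, w b) (∑ b ∈ P', w b) (∑ b ∈ K, w b) (∑ b ∈ L', w b) (∑ b ∈ K ∩ L, w b)
    (∑ b ∈ P ∩ V, w b) (∑ b ∈ O ∩ V, w b) (∑ b ∈ K ∩ V, w b) (∑ b ∈ (K ∩ L) ∩ V, w b) (∑ b ∈ L' ∩ V, w b)
    (∑ b ∈ (P ∩ P') ∩ V, w b) (∑ b ∈ (L ∩ L') ∩ V, R b) Y
    hv1 hl'0 hl'p' hmk (by linarith) (by linarith) haL' hHarV (le_trans hpair hsup) hY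

/-- **Empty primed `L`-layer (`L' = O' = ∅`), any bracket `Y ≥ (l−m)·k'`.**  Configuration sets with `O ⊆ K`, `O ⊆ L`, `L ⊆ P`, `K' ⊆ P'`;
the pair inequality at `(K∩L, K')`; Harris for `(P', P∩V)`.  Then `w(PP'V) − w(P')w(OV) + R(KK'V) − need(L,K') + (1−v)·Y ≥ 0` — the
`L' = O' = ∅` specialisation of the exchange expression; type 2: `Y = Har(P,P') + (p−k)p' + (p−l)(p'−k')`, type 1: `Y = Har(P,P') + (p−k)k' + (p−o)(p'−k')`.
[this work] -/
theorem exchange_of_emptyLayerLp [Fintype B] (w R : B → ℝ) (hw : ∀ b, 0 ≤ w b) (hw1 : ∑ b, w b = 1)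
    (V K L P O K' P' : Finset B) (Y : ℝ) (hR : ∀ b ∈ V, 0 ≤ R b)
    (hOK : O ⊆ K) (hOL : O ⊆ L) (hLP : L ⊆ P) (hKP' : K' ⊆ P')
    (hpair : (∑ b ∈ K ∩ L, w b) * (∑ b ∈ K' ∩ V, w b) + (∑ b ∈ K', w b) * (∑ b ∈ (K ∩ L) ∩ V, w b)
        - (∑ b ∈ V, w b) * (∑ b ∈ K ∩ L, w b) * (∑ b ∈ K', w b) ≤ ∑ b ∈ ((K ∩ L) ∩ K') ∩ V, R b)
    (hHarV : (∑ b ∈ P', w b) * (∑ b ∈ P ∩ V, w b) ≤ ∑ b ∈ (P ∩ P') ∩ V, w b)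
    (hY : ((∑ b ∈ L, w b) - ∑ b ∈ K ∩ L, w b) * (∑ b ∈ K', w b) ≤ Y) :
    0 ≤ (∑ b ∈ (P ∩ P') ∩ V, w b) - (∑ b ∈ P', w b) * (∑ b ∈ O ∩ V, w b)
        + (∑ b ∈ (K ∩ K') ∩ V, R b)
        - ((∑ b ∈ L, w b) * (∑ b ∈ K' ∩ V, w b) + (∑ b ∈ K', w b) * (∑ b ∈ L ∩ V, w b)
            - (∑ b ∈ V, w b) * (∑ b ∈ L, w b) * (∑ b ∈ K', w b))
        + (1 - ∑ b ∈ V, w b) * Y := by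
  have hsup : ∑ b ∈ ((K ∩ L) ∩ K') ∩ V, R b ≤ ∑ b ∈ (K ∩ K') ∩ V, R b :=
    sum_inter_le_of_subset R V (K ∩ L) K' (K ∩ K') hR
      (by intro b hb; simp only [Finset.mem_inter] at hb ⊢; exact ⟨hb.1.1, hb.2⟩)
  have hv1 : ∑ b ∈ V, w b ≤ 1 := by
    rw [← hw1]; exact sum_le_sum_of_subset' w hw (Finset.subset_univ V)
  have hk'0 : 0 ≤ ∑ b ∈ K', w b := Finset.sum_nonneg fun b _ => hw b
  have hk'p' : ∑ b ∈ K', w b ≤ ∑ b ∈ P', w b := sum_le_sum_of_subset' w hw hKP'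
  have hml : ∑ b ∈ K ∩ L, w b ≤ ∑ b ∈ L, w b := sum_le_sum_of_subset' w hw Finset.inter_subset_right
  have haK' : ∑ b ∈ K' ∩ V, w b ≤ ∑ b ∈ K', w b := sum_le_sum_of_subset' w hw Finset.inter_subset_left
  have hLM0 : ∑ b ∈ (K ∩ L) ∩ V, w b ≤ ∑ b ∈ L ∩ V, w b :=
    sum_le_sum_of_subset' w hw (Finset.inter_subset_inter Finset.inter_subset_right le_rfl)
  have h4 := trace_four w V L K P O (fun b _ => hw b) hOL hOK hLP
  rw [Finset.inter_comm L K] at h4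
  exact emptyLayerPrimed_scalar (∑ b ∈ V, w b) (∑ b ∈ P', w b) (∑ b ∈ L, w b) (∑ b ∈ K', w b) (∑ b ∈ K ∩ L, w b)
    (∑ b ∈ P ∩ V, w b) (∑ b ∈ O ∩ V, w b) (∑ b ∈ L ∩ V, w b) (∑ b ∈ (K ∩ L) ∩ V, w b) (∑ b ∈ K' ∩ V, w b)
    (∑ b ∈ (P ∩ P') ∩ V, w b) (∑ b ∈ (K ∩ K') ∩ V, R b) Y
    hv1 hk'0 hk'p' hml (by linarith) (by linarith) haK' hHarV (le_trans hpair hsup) hY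

end Summit.CriticalPhenomena.PercolationContinuityZ3.Theorems.SahiE3ExchangeEmptyLayerPrimed
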